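import Mathlib
import Literature.Combinatorics.Additive.TripleProductProperty
import Summits.MatrixMultiplication.OmegaCensus.Cyclic17Dihedral34Record

/-!
# Conjecture C1⁺ (cyclic slice): no doubled triple in `F × D_{2n}` beats `Σ dᵢ³` below order 578

Speedrun lane `tpp` (run/shared/lean/speedrun/tpp), typed by seat sr-tpp-search-g30 (2026-08-26) under the lane's
STRUCTURE.md §5 rule (a conjecture is typed once three pre-registered predictions survive: P-001.1–.3 for the odd
family, P-002.1 for the even family).  Framing: lottery ticket; floor = certified bounds/negative ranges.

**The family.**  Hosts `G = F × D_{2n}` with `F` a finite abelian group and `D_{2n} = DihedralGroup n` (Mathlib's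
convention `r i * sr j = sr (j - i)`); `A = F × ⟨r⟩` is the abelian subgroup of index two and `y = (1, sr 0)` the
doubling reflection.  A *doubled triple* is `Sₖ = Xₖ ∪ Xₖ·y` (`k = 1,2,3`) with `Xₖ ⊆ A`; it has `|Sₖ| = 2|Xₖ|`, and it
*beats* the group when `|S₁||S₂||S₃| > Σᵢ dᵢ³`, the sum of the cubes of the irreducible character degrees, which for
`F × D_{2n}` is `|F|·(4n − 2)` (`n` odd) resp. `|F|·(4n − 4)` (`n` even, `n ≥ 2`).  (All reflections of `D_{2n}` are
equivalent under `Aut(D_{2n})` fixing `⟨r⟩`, so fixing `y = (1, sr 0)` loses nothing; doubling the three sets by three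
DIFFERENT cosets is the lane's *skew* family, conjecture C3, not stated here.)

**The conjecture `NoDoubledCyclicDihedralRecordBelow578`** (= `NoDoubledDihedralRecordBelow 578`): no doubled triple in
any `F × D_{2n}` of order `< 578` beats `Σ dᵢ³`.  It is the cyclic-`N` slice of the lane's conjecture C1⁺ (STRUCTURE.md §2:
`G = F × Dih(N)`, `N` odd abelian — conjecture C1 — or `N = ℤ_{2l}`); the bound `578` is SHARP:
`not_noDoubledDihedralRecordBelow_579` below re-reads the tree's record `Cyclic17Dihedral34Record` (`C₁₇ × D₃₄`,
a doubled triple of type `(18, 8, 8)`, `1152 > 1122`) in this vocabulary.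

**Evidence (lane files; nothing of it is asserted in Lean).**  Every group of order `< 168` (lane census, WRITEUP-A.md).
Odd `n = m`: `m = 3, 5, 7` dead for every `F` by real-capacity certificates; `m = 9` dead for every order `< 578`
(pre-registered P-001.1, 42/42 label patterns UNSAT at `f = 32`); `m = 11, 13, 15` only the live support classes tested
(P-001.3/.4: 271 + 316 CSP instances UNSAT); `m = 17`: `f ≤ 16` UNSAT on the record support, `f = 17` SAT = the record.
Even `n = 2l`: `l` odd reduces to the odd family (`D_{4l} ≅ C₂ × D_{2l}`); `l = 2` dead for every `F` by the tree's
`K4Bound` (`4|S||T||U| ≤ 5|G|`); `l = 4, 6` dead for all `F` (LP certificates), `l = 8` dead below 578 (615 exact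
instances), `l = 10` for `f ≤ 13`, `l = 12` for `f ≤ 6`, `l = 14` for `f = 3` (pre-registered P-002; 2 478 117 exact
gain-graph CSP instances in total, 0 SAT).  OPEN cells below 578: `l = 10, f = 14`; `l = 12, f = 7…12`; `l = 14, f = 4…10`;
`l ≥ 16` (orders 512–576); odd `m = 11, 13, 15` outside the tested classes.  Falsifier: one SAT instance of the lane's
gain-graph CSP (`evenfam.py` / `gcsp4`) — it would be a new TPP record below 578.
-/

namespace Summit.MatrixMultiplication.OmegaCensus.SpeedrunTPP.Doubled

open Finset DihedralGroup
open Literature.Combinatorics.Additive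

/-- `x ∈ F × D_{2n}` lies in the index-two abelian subgroup `A = F × ⟨r⟩` (its dihedral component is a rotation). -/
def InRot {F : Type*} {n : ℕ} (x : Multiplicative F × DihedralGroup n) : Prop :=
  ∃ i : ZMod n, x.2 = r i

/-- The doubled set `X ∪ X·y` of `X ⊆ F × D_{2n}`, `y = (1, sr 0)`. -/
def dbl {F : Type*} [AddCommGroup F] [DecidableEq F] {n : ℕ} (X : Finset (Multiplicative F × DihedralGroup n)) :
    Finset (Multiplicative F × DihedralGroup n) :=
  X ∪ X.image (fun x => x * ((1 : Multiplicative F), sr (0 : ZMod n)))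

/-- `Σᵢ dᵢ³` over the irreducible complex characters of `F × D_{2n}` (`|F| = f`, `F` abelian, `n ≥ 1`): `D_{2n}` has
`2` linear characters and `(n−1)/2` of degree `2` for odd `n`, `4` linear and `(n−2)/2` of degree `2` for even `n`,
whence `f·(4n − 2)` resp. `f·(4n − 4)`.  [folklore] -/
def sumCubes (f n : ℕ) : ℕ :=
  if Even n then f * (4 * n - 4) else f * (4 * n - 2)

/-- **No doubled record below order `N`:** for every finite abelian `F` and `n ≥ 1` with `|F|·2n < N`, every doubled
triple `(X₁ ∪ X₁y, X₂ ∪ X₂y, X₃ ∪ X₃y)` (`Xₖ ⊆ F × ⟨r⟩`) with the triple product property has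
`8·|X₁||X₂||X₃| ≤ Σᵢ dᵢ³ = sumCubes |F| n`. (speedrun lane `tpp`, conjecture schema) -/
def NoDoubledDihedralRecordBelow (N : ℕ) : Prop :=
  ∀ (F : Type) [AddCommGroup F] [Fintype F] [DecidableEq F] (n : ℕ) [NeZero n],
    Fintype.card F * (2 * n) < N →
    ∀ X₁ X₂ X₃ : Finset (Multiplicative F × DihedralGroup n),
      (∀ x ∈ X₁, InRot x) → (∀ x ∈ X₂, InRot x) → (∀ x ∈ X₃, InRot x) →
      TripleProductProperty (dbl X₁) (dbl X₂) (dbl X₃) →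
      8 * (X₁.card * X₂.card * X₃.card) ≤ sumCubes (Fintype.card F) n

/-- **Conjecture C1⁺, cyclic slice (speedrun lane `tpp`, 2026-08-26): no doubled triple in any `F × D_{2n}` of order
`< 578` beats `Σᵢ dᵢ³`.**  OPEN; evidence and open cells in the module docstring; asserted nowhere. -/
def NoDoubledCyclicDihedralRecordBelow578 : Prop :=
  NoDoubledDihedralRecordBelow 578

/-- Bookkeeping: `Σ d³ (C₁₇ × D₃₄) = 17 · 66 = 1122`. -/
theorem sumCubes_17_17 : sumCubes 17 17 = 1122 := by decide

/-- Bookkeeping: `Σ d³ (F × D₈) = 12·|F|`, against which the tree's `K4Bound` (`|S||T||U| ≤ 5|G|/4 = 10|F|`) kills `l = 2`. -/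
theorem sumCubes_four (f : ℕ) : sumCubes f 4 = 12 * f := by
  simp [sumCubes, show Even 4 from ⟨2, rfl⟩]; omega

section Sharpness

open Summit.MatrixMultiplication.OmegaCensus.Cyclic17Dihedral34Record

/-- The rotation halves `Xₖ = {(c^{ε d}, r^d) : d ∈ Dₖ}` of the record triple of `Cyclic17Dihedral34Record`. -/
def half (ε : ZMod 17) (D : Finset (ZMod 17)) : Finset (Multiplicative (ZMod 17) × DihedralGroup 17) :=
  D.image fun d => (Multiplicative.ofAdd (ε * d), r d)

/-- The doubled halves lie inside the record sets: `Xₖ ∪ Xₖ·y ⊆ Sₖ` with `y = (1, sr 0)` (in fact equality holds: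
`(c^{εd}, r^d)·(1, sr 0) = (c^{εd}, sr (−d))`; the inclusion is what `TripleProductProperty.mono` needs; kernel `decide`). -/
theorem dbl_half_subset :
    dbl (half (-1) D1) ⊆ S1 ∧ dbl (half 1 D2) ⊆ S2 ∧ dbl (half 1 D3) ⊆ S3 := by
  refine ⟨?_, ?_, ?_⟩ <;> decide +kernel

/-- Every element of a half has a rotation as dihedral component. -/
theorem half_inRot (ε : ZMod 17) (D : Finset (ZMod 17)) : ∀ x ∈ half ε D, InRot x := by
  intro x hx
  simp only [half, Finset.mem_image] at hx
  obtain ⟨d, -, rfl⟩ := hx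
  exact ⟨d, rfl⟩

/-- The halves have sizes `9, 4, 4` (kernel `decide`). -/
theorem half_card : (half (-1) D1).card = 9 ∧ (half 1 D2).card = 4 ∧ (half 1 D3).card = 4 := by
  refine ⟨?_, ?_, ?_⟩ <;> decide +kernel

/-- **`578` is sharp:** the tree's record `C₁₇ × D₃₄ ⊇ (S₁, S₂, S₃)` (`Cyclic17Dihedral34Record.tpp`) is a doubled triple of
order `578` with `8 · 9 · 4 · 4 = 1152 > 1122 = Σ d³`, so `NoDoubledDihedralRecordBelow 579` fails.
(speedrun lane `tpp`, 2026-08-26) -/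
theorem not_noDoubledDihedralRecordBelow_579 : ¬ NoDoubledDihedralRecordBelow 579 := by
  intro h
  obtain ⟨c1, c2, c3⟩ := half_card
  obtain ⟨s1, s2, s3⟩ := dbl_half_subset
  have hcard : Fintype.card (ZMod 17) * (2 * 17) < 579 := by simp [ZMod.card]
  have := h (ZMod 17) 17 hcard (half (-1) D1) (half 1 D2) (half 1 D3)
    (half_inRot _ _) (half_inRot _ _) (half_inRot _ _) (tpp.mono s1 s2 s3)
  rw [c1, c2, c3, ZMod.card, sumCubes_17_17] at this
  omega

end Sharpness

end Summit.MatrixMultiplication.OmegaCensus.SpeedrunTPP.Doubled
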